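import Literature.NumberTheory.EllipticCurves.Rank1Residual.Typed.X11Three
import Literature.NumberTheory.EllipticCurves.BSDShaProofs
import HarnessLib

/-!
# The LOWER half from a finite certificate: Cassels–Tate squareness + `p ∣ #Ш` (cell `b2b-bsdres`)

HONEST FRAMING (run/shared/lean/b2b/bsd-rank1-residual/, verbatim): the goal of the cell is to
DELETE the COMBINATION-SHAPED residual classes for ALL analytic-rank `≤ 1` elliptic curves over `ℚ`
— "full BSD formula for every rank `≤ 1` curve in class C" assembled STRICTLY from published
theorems — so that the rank-`≤ 1` remainder becomes exactly the CONSTRUCTION-SHAPED classes, which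
are TYPED (missing-input `Prop`s), NOT attempted. This is not "finishing BSD".

Theorems only (no definition, no new named fact). Companion of `Typed/WuthrichUpperBound.lean`.

**What this file records.** At a rank-`0` pair `(E, p)` where the UPPER half
`ord_p #Ш ≤ ord_p #Ш_an` is in print (Wuthrich, Doc. Math. 19 (2014) Prop. 21: odd `p`, not
additive, `ρ̄_{E,p}` surjective or Borel) the typed missing input is the LOWER half
`MissingLowerBoundAt W p` (`Typed/Basic.lean`). When `ord_p #Ш(E/ℚ)_an ≤ 2k`, that lower half is
NOT a missing theorem but a FINITE CERTIFICATE: by Cassels' theorem (the Cassels–Tate pairing is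
alternating and non-degenerate on a finite `Ш`, so `#Ш(E/K)` is a perfect square — Cassels, J. reine
angew. Math. 211 (1962); Silverman, *AEC* 2nd ed., Thm. X.4.14 "in particular"; tree: the named fact
`WeierstrassCurve.exists_casselsTate_pairing` = bsd.S18 and its sorry-free corollary
`WeierstrassCurve.isSquare_shaOrder_of_casselsTate`, `BSDShaProofs.lean`) the `p`-adic valuation of
`#Ш` is EVEN, so `p^{2k-1} ∣ #Ш(E/ℚ)` already forces `2k ≤ ord_p #Ш`, and with the upper bound
`ord_p #Ш ≤ ord_p #Ш_an ≤ 2k` equality follows: `BSD(E,p)`. For `k = 1` (`#Ш_an` exactly divisible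
by `p²`, the only case met in the census below `10⁴` at odd `p`) the certificate is ONE nonzero
element of `Ш(E/ℚ)` killed by `p` (`dvd_shaOrder_of_exists_torsion`), i.e. `Ш(E/ℚ)[p] ≠ 0` — the
output of a `p`-descent (`#Sel^{(p)}(E/ℚ) > #E(ℚ)/p`, Schaefer–Stoll 2004 / Cremona–Fisher–Stoll for
`p = 3`) or of a visibility argument (Cremona–Mazur 2000, Agashe–Stein 2002), a per-curve
computation with a published correctness proof (RESIDUAL-CASES.md lever type L3; the lane owns
verdicts). Nothing here is a class theorem: the certificate is per curve.

**Where it bites (census v4, `N < 10⁴`, collector 2026-08-18T17:24:45Z; numbers are the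
writer's table `residue_classes_v4.tsv`, lane to certify).** Rank-`0` residue pairs with `p ∣ #Ш_an`
at an odd NON-additive `p` with surjective-or-Borel image — all have `#Ш_an = 9`, `p = 3`:
X11 (`3 ‖ N`, `ρ̄_{E,3}` surjective, `¬ram(3)`): `5808h1`, `8664o1` — the two rank-`0` pairs of X11
at `p = 3` left "typed (lower bound)" by `Typed/X11Three.lean`; X6: `2534e1, 4343b1, 4963c1, 5561a1,
8710b1`; X7: `2932a1, 4675j1, 7088a1, 8720e1`; X8: `2534f1, 4229a1, 4592f1, 6118f1, 7234b1, 7310d1,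
8510c1, 8747d1, 9878f1, 9950f1`; X2 (Borel): `5568g1`; (X1: `2366d1, 7154c1`, already closed up to
isogeny by `ClassX1.lean`). For each, `BSD(E,3)` ⇐ [Wuthrich Prop. 21 + Cassels + GZK + modularity,
all PUBLISHED] + [the finite certificate `Ш(E)[3] ≠ 0`].

**This file proves** (binders: `hCT` = bsd.S18 Cassels–Tate pairing, `hW` = Wuthrich Prop. 21,
`hGZK` = bsd.S17 Gross–Zagier–Kolyvagin, `hmod` = modularity; all published):
* `two_mul_le_padicValNat_of_isSquare_of_pow_dvd` — arithmetic: `n ≠ 0` square, `p^{2k-1} ∣ n` ⇒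
  `2k ≤ ord_p n`;
* `dvd_shaOrder_of_exists_torsion`, `pow_dvd_shaOrder_of_injective` — the certificate shapes
  (`Ш[p] ≠ 0` ⇒ `p ∣ #Ш`; `(ℤ/p)^m ↪ Ш` ⇒ `p^m ∣ #Ш`);
* `missingLowerBoundAt_of_casselsTate_of_pow_dvd` — the typed LOWER half from the certificate;
* `bsdp_of_wuthrich_of_casselsTate_of_pow_dvd` / `…_of_dvd` — `BSD(E,p)` at such rank-`0` pairs;
* `X11ThreeRankZero.missingInputAt_of_casselsTate_of_three_dvd`,
  `X11ThreeRankZero.bsdp_of_casselsTate_of_three_dvd` — the X11 ∧ `p = 3` ∧ `r = 0` instances over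
  `ClassX11 W 3` (the cell's canonical shape).

References: Cassels 1962 [Cassels1962ArithmeticIV]; Silverman AEC X.4.14 [SilvermanAEC2009];
Wuthrich 2014 Prop. 21 [Wuthrich2014]; Miller 2011 §1, Def. 1.1 [Miller2011LMS]; Schaefer–Stoll,
Trans. AMS 356 (2004) 1209–1231; Cremona–Mazur, Exp. Math. 9 (2000) 13–28; cell files
`b2b-bsdres-x11b/X11B-AUDIT.md` §11, REFEREE.md R6.2/R6.3.
-/

noncomputable section

open scoped Classical

open WeierstrassCurve Literature.NumberTheory.EllipticCurves
  Literature.NumberTheory.EllipticCurves.Rank1Residual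
  Literature.NumberTheory.EllipticCurves.Wuthrich2014

namespace Literature.NumberTheory.EllipticCurves.Rank1Residual.Typed

/-! ### Arithmetic of squares -/

/-- A nonzero perfect square divisible by `p^{2k-1}` is divisible by `p^{2k}`: `2k ≤ ord_p n`
(the valuation of a square is even). Elementary. [folklore] -/
theorem two_mul_le_padicValNat_of_isSquare_of_pow_dvd {p n k : ℕ} [Fact p.Prime] (hsq : IsSquare n)
    (hn : n ≠ 0) (hdvd : p ^ (2 * k - 1) ∣ n) : 2 * k ≤ padicValNat p n := by
  obtain ⟨r, rfl⟩ := hsq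
  have hr : r ≠ 0 := fun h => hn (by simp [h])
  have hle : 2 * k - 1 ≤ padicValNat p (r * r) := (padicValNat_dvd_iff_le hn).1 hdvd
  rw [padicValNat.mul hr hr] at hle ⊢
  omega

/-- Special case `k = 1`: a nonzero perfect square divisible by `p` has `2 ≤ ord_p`. [folklore] -/
theorem two_le_padicValNat_of_isSquare_of_dvd {p n : ℕ} [Fact p.Prime] (hsq : IsSquare n)
    (hn : n ≠ 0) (hdvd : p ∣ n) : 2 ≤ padicValNat p n := by
  simpa using two_mul_le_padicValNat_of_isSquare_of_pow_dvd (k := 1) hsq hn (by simpa using hdvd)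

/-! ### Certificate shapes: from elements of `Ш` to divisibility of `#Ш` -/

variable (W : WeierstrassCurve ℚ) [W.IsElliptic] (p : ℕ) [Fact p.Prime]

omit [W.IsElliptic] in
/-- **Certificate shape (one element).** A nonzero element of `Ш(E/ℚ)` killed by the prime `p` has
order `p`, so `p ∣ #Ш(E/ℚ)` (Lagrange; `#Ш := Nat.card`, which is `0` for an infinite group, so no
finiteness hypothesis is needed). This is what "`Ш(E/ℚ)[p] ≠ 0`" — e.g. from a
`p`-descent with `#Sel^{(p)}(E/ℚ) > #(E(ℚ)/pE(ℚ))` — delivers. [folklore] -/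
theorem dvd_shaOrder_of_exists_torsion
    (h : ∃ x : W.sha, x ≠ 0 ∧ p • x = 0) : p ∣ W.shaOrder := by
  obtain ⟨x, hx0, hpx⟩ := h
  rw [WeierstrassCurve.shaOrder, ← addOrderOf_eq_prime hpx hx0]
  exact addOrderOf_dvd_natCard x

omit [W.IsElliptic] in
/-- **Certificate shape (a subgroup `(ℤ/p)^m`).** An injective additive map `(ℤ/pℤ)^m → Ш(E/ℚ)`
gives `p^m ∣ #Ш(E/ℚ)` (Lagrange; `Nat.card`, no finiteness needed) — the shape in which a
`p`-descent reports `dim_{𝔽_p} Ш(E/ℚ)[p] ≥ m`. [folklore] -/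
theorem pow_dvd_shaOrder_of_injective {m : ℕ}
    (f : (Fin m → ZMod p) →+ W.sha) (hf : Function.Injective f) : p ^ m ∣ W.shaOrder := by
  haveI : NeZero p := ⟨(Fact.out : p.Prime).ne_zero⟩
  have hcard : Nat.card (Fin m → ZMod p) = p ^ m := by
    rw [Nat.card_eq_fintype_card, Fintype.card_fun, ZMod.card, Fintype.card_fin]
  rw [WeierstrassCurve.shaOrder, ← hcard]
  exact AddSubgroup.card_dvd_of_injective f hf

/-! ### The typed lower half from the certificate -/

/-- **Cassels–Tate squareness turns the certificate into the LOWER half.** If `Ш(E/ℚ)` is finite,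
`#Ш(E/ℚ)_an` is a rational `q` with `ord_p q ≤ 2k`, and `p^{2k-1} ∣ #Ш(E/ℚ)`, then
`ord_p #Ш_an ≤ ord_p #Ш` (`MissingLowerBoundAt W p`): `#Ш` is a perfect square by the Cassels–Tate
pairing (`hCT` = bsd.S18, `isSquare_shaOrder_of_casselsTate`), so `2k ≤ ord_p #Ш`.
[cite: SilvermanAEC2009, Thm. X.4.14] [cite: Miller2011LMS, Def. 1.1 (arXiv:1010.2431 p. 3)] -/
theorem missingLowerBoundAt_of_casselsTate_of_pow_dvd
    (hCT : exists_casselsTate_pairing (K := ℚ)) (hfin : W.ShaFinite) {q : ℚ}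
    (hq : shaAn W = (q : ℂ)) {k : ℕ} (hv : padicValRat p q ≤ 2 * k)
    (hdvd : p ^ (2 * k - 1) ∣ W.shaOrder) : MissingLowerBoundAt W p := by
  have hsq : IsSquare W.shaOrder := isSquare_shaOrder_of_casselsTate hCT W hfin
  have hn : W.shaOrder ≠ 0 := (WeierstrassCurve.shaOrder_pos W hfin).ne'
  have hle : 2 * k ≤ padicValNat p W.shaOrder :=
    two_mul_le_padicValNat_of_isSquare_of_pow_dvd hsq hn hdvd
  refine ⟨q, hq, hv.trans ?_⟩
  exact_mod_cast hle

/-! ### `BSD(E,p)` at rank-`0` pairs where the upper half is Wuthrich's -/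

variable [W.IsGloballyMinimal]

/-- **Rank `0`, odd non-additive `p`, surjective-or-Borel image, `ord_p #Ш_an ≤ 2k`, certificate
`p^{2k-1} ∣ #Ш` ⇒ `BSD(E,p)`.** Upper half: Wuthrich 2014 Prop. 21 (`hW`,
`bsdp_of_missingLowerBoundAt_of_wuthrich`); lower half: Cassels–Tate squareness (`hCT`) and the
certificate (`missingLowerBoundAt_of_casselsTate_of_pow_dvd`); `Ш` finite and `rank = 0` by
Gross–Zagier–Kolyvagin (`hGZK`); modularity (`hmod`) for `r_an = 0 ⇒ L(E,1) ≠ 0`. All four inputs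
are published theorems; the certificate is per curve. [cite: Wuthrich2014, Prop. 21 (p. 400)]
[cite: SilvermanAEC2009, Thm. X.4.14] [cite: Miller2011LMS, §1 and Def. 1.1] -/
theorem bsdp_of_wuthrich_of_casselsTate_of_pow_dvd (hCT : exists_casselsTate_pairing (K := ℚ))
    (hW : sha_dvd_analyticSha) (hGZK : rank_eq_analyticRank_of_analyticRank_le_one)
    (hmod : hasEntireLFunction_rat) (hp : p ≠ 2) (hr : W.analyticRank = 0)
    (hadd : ¬ ((W.baseChange ℚ_[p]).minimal ℤ_[p]).HasAdditiveReduction ℤ_[p])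
    (himg : ¬ W.HasIrreducibleModPGaloisRep p ∨ W.HasSurjectiveModNGaloisRep p)
    {q : ℚ} (hq : shaAn W = (q : ℂ)) {k : ℕ} (hv : padicValRat p q ≤ 2 * k)
    (hdvd : p ^ (2 * k - 1) ∣ W.shaOrder) : BSDp W p :=
  bsdp_of_missingLowerBoundAt_of_wuthrich W p hW hGZK hmod hp hr hadd himg
    (missingLowerBoundAt_of_casselsTate_of_pow_dvd W p hCT (hGZK W (by omega)).2 hq hv hdvd)

/-- **The `k = 1` case** (the only one met below conductor `10⁴` at odd `p`: `#Ш_an = 9`, `p = 3`):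
rank `0`, odd non-additive `p`, surjective-or-Borel image, `ord_p #Ш_an ≤ 2`, and ONE certificate
`p ∣ #Ш(E/ℚ)` (i.e. `Ш(E/ℚ)[p] ≠ 0`, `dvd_shaOrder_of_exists_torsion`) ⇒ `BSD(E,p)`.
[cite: Wuthrich2014, Prop. 21 (p. 400)] [cite: SilvermanAEC2009, Thm. X.4.14]
[cite: Miller2011LMS, §1 and Def. 1.1] -/
theorem bsdp_of_wuthrich_of_casselsTate_of_dvd (hCT : exists_casselsTate_pairing (K := ℚ))
    (hW : sha_dvd_analyticSha) (hGZK : rank_eq_analyticRank_of_analyticRank_le_one)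
    (hmod : hasEntireLFunction_rat) (hp : p ≠ 2) (hr : W.analyticRank = 0)
    (hadd : ¬ ((W.baseChange ℚ_[p]).minimal ℤ_[p]).HasAdditiveReduction ℤ_[p])
    (himg : ¬ W.HasIrreducibleModPGaloisRep p ∨ W.HasSurjectiveModNGaloisRep p)
    {q : ℚ} (hq : shaAn W = (q : ℂ)) (hv : padicValRat p q ≤ 2) (hdvd : p ∣ W.shaOrder) :
    BSDp W p :=
  bsdp_of_wuthrich_of_casselsTate_of_pow_dvd W p hCT hW hGZK hmod hp hr hadd himg hq (k := 1)
    (by simpa using hv) (by simpa using hdvd)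

/-! ### X11 at `p = 3`, rank `0`: the two census pairs `5808h1`, `8664o1` (`#Ш_an = 9`) -/

omit [W.IsGloballyMinimal] in
/-- **X11 ∧ `p = 3` ∧ `r = 0`: the typed input is DISCHARGED by the finite certificate.** For a
globally minimal `E/ℚ` in class X11 at `3` with `ord_{s=1} L(E,s) = 0`, `ρ̄_{E,3}` surjective,
`#Ш(E/ℚ)_an` a rational of `3`-adic valuation `≤ 2`, and `3 ∣ #Ш(E/ℚ)`, the typed missing input
`X11ThreeRankZero.MissingInputAt W` of `Typed/X11Three.lean` HOLDS (its lower-bound conjunct by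
Cassels–Tate squareness `hCT`, its second conjunct vacuously). Census: `5808h1`, `8664o1`
(`#Ш_an = 9`; certificate = `Ш(E)[3] ≠ 0`, a `3`-descent, lane to run). NOT a class theorem.
[cite: SilvermanAEC2009, Thm. X.4.14] [cite: Miller2011LMS, Def. 1.1] -/
theorem X11ThreeRankZero.missingInputAt_of_casselsTate_of_three_dvd
    (hCT : exists_casselsTate_pairing (K := ℚ))
    (hGZK : rank_eq_analyticRank_of_analyticRank_le_one) (hr : W.analyticRank = 0)
    (hsurj : Surj W 3) {q : ℚ} (hq : shaAn W = (q : ℂ)) (hv : padicValRat 3 q ≤ 2)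
    (hdvd : 3 ∣ W.shaOrder) : X11ThreeRankZero.MissingInputAt W :=
  ⟨fun _ => missingLowerBoundAt_of_casselsTate_of_pow_dvd W 3 hCT (hGZK W (by omega)).2 hq
      (k := 1) (by simpa using hv) (by simpa using hdvd),
    fun h => absurd hsurj h⟩

/-- **X11 ∧ `p = 3` ∧ `r = 0` with `ord_3 #Ш_an ≤ 2`: `BSD(E,3)` from PUBLISHED theorems plus the
finite certificate `3 ∣ #Ш(E/ℚ)`.** Inputs: Wuthrich 2014 Prop. 21 (`hW`; multiplicative `3` is not
additive; surjective image), Cassels–Tate squareness (`hCT`), Gross–Zagier–Kolyvagin (`hGZK`),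
modularity (`hmod`). Census (`N < 10⁴`): exactly the two rank-`0` X11 pairs at `p = 3` not already
closed by `bsdp_of_classX11_rankZero_surj_of_shaAn_unit` — `5808h1@3`, `8664o1@3`, `#Ш_an = 9` —
become per-curve certificate candidates (certificate: `Ш(E)[3] ≠ 0`, e.g. `#Sel^{(3)}(E/ℚ) = 9` by a
`3`-descent; lane to run and to rule). SUB-class statement; NOT a deletion of X11's rank-`0` clause
(pairs with `ord_3 #Ш_an ≥ 4`, or without the certificate, stay typed).
[cite: Wuthrich2014, Prop. 21 (p. 400)] [cite: SilvermanAEC2009, Thm. X.4.14]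
[cite: Miller2011LMS, §1 and Def. 1.1] -/
theorem X11ThreeRankZero.bsdp_of_casselsTate_of_three_dvd
    (hCT : exists_casselsTate_pairing (K := ℚ)) (hW : sha_dvd_analyticSha)
    (hGZK : rank_eq_analyticRank_of_analyticRank_le_one) (hmod : hasEntireLFunction_rat)
    (hr : W.analyticRank = 0) (hX : ClassX11 W 3) (hsurj : Surj W 3)
    {q : ℚ} (hq : shaAn W = (q : ℂ)) (hv : padicValRat 3 q ≤ 2) (hdvd : 3 ∣ W.shaOrder) :
    BSDp W 3 :=
  X11ThreeRankZero.bsdp_of_missingInputAt hW hGZK hmod W hr hX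
    (X11ThreeRankZero.missingInputAt_of_casselsTate_of_three_dvd W hCT hGZK hr hsurj hq hv hdvd)

end Literature.NumberTheory.EllipticCurves.Rank1Residual.Typed
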